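import Literature.Analysis.FluidPDE.PassiveScalarForcedRenormalized
import Literature.Analysis.FluidPDE.PassiveScalarPairingTools
import Literature.Analysis.FluidPDE.PassiveScalarSteadyTest
import Literature.Analysis.FluidPDE.LerayHopfTranslate
import HarnessLib

/-!
# The trace of a sourced weak passive scalar against a steady smooth field, through the
# mollified time primitive

Analysis/FluidPDE proof-support file (everything proved). For a weak solution `a` of
`∂ₜa + u·∇a = κΔa + s` on `T^d × [0,T)` with datum `a₀` (`Torus.IsWeakScalarTransportForcedOn`),
a smooth steady field `g` and a time `σ ∈ [0, T)`, the **trace** of `t ↦ ∫ a(t) g` at `σ` is the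
value of its absolutely continuous representative (`PassiveScalarSteadyTest`),

  `P_g(σ) = ∫ a₀ g + ∫_{(0,σ]} ( ∫ a(τ) (⟪u(τ), ∇g⟫ + κ Δg) + ∫ s(τ) g ) dτ`.

With an even smooth kernel `k` and the continuous-in-time mollified primitive
`Φ(σ, x) = (a₀ ⋆ k)(x) + ∫_{(0,σ]} (G(τ, x) + (s(τ) ⋆ k)(x)) dτ` of the mollified equation
(`PassiveScalarForcedMollified`; `G` the mollified flux), we prove

* `integral_molIntRep_mul_eq_trace` — `∫ Φ(σ, x) g(x) dx = P_{g ⋆ k}(σ)` for EVERY `σ`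
  (adjoint of the mollified flux, `PassiveScalarPairingTools.integral_mul_fluxIntegral_eq`);
* `tendsto_trace_convolution` — `P_{g ⋆ kₙ}(σ) → P_g(σ)` along unit-mass kernels `kₙ ≥ 0`
  shrinking to a point (uniform `C²` convergence of `g ⋆ kₙ`);
* bookkeeping used by the pairing identities: integrability of `x ↦ Φ(σ, x)`, and time
  translation of integrability / joint measurability on `(0,T) × T^d`.

These identify the initial term of the pairing identities between two weak passive scalars
started at different times (age-decoupling argument, `FluidPDE/AgeDecouplingInequality`).

## References

* R. J. DiPerna, P.-L. Lions, Invent. Math. 98 (1989), 511–547, §II.1, (13)–(14). [`DiPernaLions1989`]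
-/

noncomputable section

open MeasureTheory TopologicalSpace Set Function Filter Topology Metric ContinuousLinearMap
  UnitAddTorus
open scoped ENNReal NNReal Convolution ContDiff InnerProductSpace

namespace Literature.Analysis.FluidPDE

namespace Torus

variable {d : Type*} [Fintype d]

/-! ## Time translation on `(0,T) × T^d` -/

section Translate

omit [Fintype d] in
/-- Integrability on an interval is preserved by translating the time variable. [folklore] -/
theorem integrableOn_Ioo_comp_add_left {E : Type*} [NormedAddCommGroup E] {F : ℝ → E} {σ b : ℝ}
    (h : IntegrableOn F (Ioo σ (σ + b)) volume) :
    IntegrableOn (fun t => F (σ + t)) (Ioo 0 b) volume := by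
  have hmp : MeasurePreserving (fun t : ℝ => σ + t) volume volume := measurePreserving_add_left volume σ
  have hme : MeasurableEmbedding (fun t : ℝ => σ + t) := (MeasurableEquiv.addLeft σ).measurableEmbedding
  have hpre : (fun t : ℝ => σ + t) ⁻¹' Ioo σ (σ + b) = Ioo 0 b := by
    ext t; simp
  have := (hmp.integrableOn_comp_preimage hme (f := F) (s := Ioo σ (σ + b))).2 h
  rwa [hpre] at this

omit [Fintype d] in
/-- Splitting a time primitive at `σ` and translating the second piece:
`∫_{(0,σ+t]} F = ∫_{(0,σ]} F + ∫_{(0,t]} F(σ + ·)` for `F` integrable on `(0,T)`, `σ, t ≥ 0`,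
`σ + t ≤ T`. [folklore] -/
theorem setIntegral_Ioc_eq_add_comp_add_left {E : Type*} [NormedAddCommGroup E] [NormedSpace ℝ E]
    {F : ℝ → E} {T σ t : ℝ} (hF : IntegrableOn F (Ioo 0 T) volume) (hσ : 0 ≤ σ) (ht : 0 ≤ t)
    (hT : σ + t ≤ T) :
    ∫ s in Ioc 0 (σ + t), F s = (∫ s in Ioc 0 σ, F s) + ∫ s in Ioc 0 t, F (σ + s) := by
  have hF' : IntegrableOn F (Ioc 0 T) volume := hF.congr_set_ae Ioo_ae_eq_Ioc.symm
  have h1 : IntervalIntegrable F volume 0 σ :=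
    (intervalIntegrable_iff_integrableOn_Ioc_of_le hσ).2 (hF'.mono_set (Ioc_subset_Ioc_right (by linarith)))
  have h2 : IntervalIntegrable F volume σ (σ + t) :=
    (intervalIntegrable_iff_integrableOn_Ioc_of_le (by linarith)).2
      (hF'.mono_set (Ioc_subset_Ioc hσ hT))
  rw [← intervalIntegral.integral_of_le (by linarith : 0 ≤ σ + t), ← intervalIntegral.integral_of_le hσ,
    ← intervalIntegral.integral_of_le ht, ← intervalIntegral.integral_add_adjacent_intervals h1 h2,
    intervalIntegral.integral_comp_add_left F σ, add_zero]

/-- The time translation `(t, x) ↦ (σ + t, x)` is measure preserving from `(0,T') × T^d` to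
`(σ, σ+T') × T^d`. [folklore] -/
theorem measurePreserving_add_left_prod (σ T' : ℝ) :
    MeasurePreserving (fun p : ℝ × UnitAddTorus d => (σ + p.1, p.2))
      (((volume : Measure ℝ).restrict (Ioo 0 T')).prod volume)
      (((volume : Measure ℝ).restrict (Ioo σ (σ + T'))).prod volume) := by
  have h1 : MeasurePreserving (fun t : ℝ => σ + t) ((volume : Measure ℝ).restrict (Ioo 0 T'))
      ((volume : Measure ℝ).restrict (Ioo σ (σ + T'))) := by
    have hmp : MeasurePreserving (fun t : ℝ => σ + t) volume volume := measurePreserving_add_left volume σ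
    have h := hmp.restrict_preimage (measurableSet_Ioo (a := σ) (b := σ + T'))
    have hpre : (fun t : ℝ => σ + t) ⁻¹' Ioo σ (σ + T') = Ioo 0 T' := by
      ext t; simp
    rwa [hpre] at h
  exact h1.prod (MeasurePreserving.id volume)

/-- Joint measurability on `(0,T) × T^d` passes to the time translate on `(0,T') × T^d` when
`(σ, σ + T') ⊆ (0, T)`. [folklore] -/
theorem aestronglyMeasurable_uncurry_comp_add_left {E : Type*} [TopologicalSpace E]
    {F : ℝ → UnitAddTorus d → E} {T σ T' : ℝ}
    (h : AEStronglyMeasurable (uncurry F) (((volume : Measure ℝ).restrict (Ioo 0 T)).prod volume))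
    (hσ : 0 ≤ σ) (hT' : σ + T' ≤ T) :
    AEStronglyMeasurable (uncurry fun t x => F (σ + t) x) (((volume : Measure ℝ).restrict (Ioo 0 T')).prod volume) := by
  have hle : ((volume : Measure ℝ).restrict (Ioo σ (σ + T'))).prod (volume : Measure (UnitAddTorus d)) ≤
      ((volume : Measure ℝ).restrict (Ioo 0 T)).prod volume :=
    Measure.prod_mono (Measure.restrict_mono_set _ (Ioo_subset_Ioo hσ hT')) le_rfl
  have h' := h.mono_measure hle
  have e : (uncurry fun t x => F (σ + t) x) = uncurry F ∘ fun p : ℝ × UnitAddTorus d => (σ + p.1, p.2) := by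
    funext p; rfl
  rw [e]
  exact h'.comp_measurePreserving (measurePreserving_add_left_prod σ T')

omit [Fintype d] in
/-- An a.e. property on `(0,T)` holds a.e. along the time translate on `(0,T')` when
`(σ, σ + T') ⊆ (0, T)`. [folklore] -/
theorem ae_restrict_Ioo_comp_add_left {T σ T' : ℝ} {P : ℝ → Prop}
    (h : ∀ᵐ t ∂((volume : Measure ℝ).restrict (Ioo 0 T)), P t) (hσ : 0 ≤ σ) (hT' : σ + T' ≤ T) :
    ∀ᵐ t ∂((volume : Measure ℝ).restrict (Ioo 0 T')), P (σ + t) := by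
  have h1 : ∀ᵐ t ∂((volume : Measure ℝ).restrict (Ioo (0 + σ) (T' + σ))), P t := by
    refine ae_restrict_of_ae_restrict_of_subset (Ioo_subset_Ioo (by linarith) (by linarith)) h
  have h2 := ae_restrict_Ioo_comp_add_right σ (P := P) h1
  filter_upwards [h2] with t ht
  rwa [add_comm] at ht

end Translate

namespace IsWeakScalarTransportForcedOn

variable {T κ : ℝ} {u : ℝ → UnitAddTorus d → EuclideanSpace ℝ d} {s : ℝ → UnitAddTorus d → ℝ}
  {θ₀ : UnitAddTorus d → ℝ} {θ : ℝ → UnitAddTorus d → ℝ}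

/-! ## The mollified time primitive at a fixed time is integrable in `x` -/

/-- The time integral of the mollified flux plus source, `x ↦ ∫_{(0,σ]} (G(τ,x) + S(τ,x)) dτ`,
is bounded and measurable, hence integrable on `T^d` (`σ < T`). [folklore] -/
theorem integrable_setIntegral_fluxSource (h : IsWeakScalarTransportForcedOn T κ u s θ₀ θ)
    {k : UnitAddTorus d → ℝ} (hk : FunctionSpaces.Torus.IsSmooth k) {σ : ℝ} (hσT : σ < T) :
    Integrable (fun x => ∫ τ in Ioc 0 σ, ((∫ y, θ τ y *
        (-⟪u τ y, FunctionSpaces.Torus.gradient k (x - y)⟫_ℝ + κ * FunctionSpaces.Torus.laplacian k (x - y))) +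
        ∫ y, s τ y * k (x - y))) volume := by
  set μT : Measure ℝ := (volume : Measure ℝ).restrict (Ioo 0 T) with hμT
  obtain ⟨bound, hbi, hGb⟩ := h.exists_flux_bound₁ hk
  have hsub : Ioc 0 σ ⊆ Ioo 0 T := Ioc_subset_Ioo_right hσT
  have hle : (volume : Measure ℝ).restrict (Ioc 0 σ) ≤ μT := Measure.restrict_mono_set _ hsub
  -- joint measurability of the integrand, swapped
  have hm : AEStronglyMeasurable (uncurry fun τ x => (∫ y, θ τ y *
      (-⟪u τ y, FunctionSpaces.Torus.gradient k (x - y)⟫_ℝ + κ * FunctionSpaces.Torus.laplacian k (x - y))) +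
      ∫ y, s τ y * k (x - y)) (((volume : Measure ℝ).restrict (Ioc 0 σ)).prod volume) :=
    ((h.aestronglyMeasurable_uncurry_flux₁ hk).add (h.aestronglyMeasurable_uncurry_sourceMol hk.continuous)).mono_measure
      (Measure.prod_mono hle le_rfl)
  have hmeas : AEStronglyMeasurable (fun x => ∫ τ in Ioc 0 σ, ((∫ y, θ τ y *
      (-⟪u τ y, FunctionSpaces.Torus.gradient k (x - y)⟫_ℝ + κ * FunctionSpaces.Torus.laplacian k (x - y))) +
      ∫ y, s τ y * k (x - y))) volume :=
    hm.prod_swap.integral_prod_right'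
  refine Integrable.mono' (integrable_const (∫ τ, bound τ ∂μT)) hmeas (Eventually.of_forall fun x => ?_)
  calc ‖∫ τ in Ioc 0 σ, ((∫ y, θ τ y *
        (-⟪u τ y, FunctionSpaces.Torus.gradient k (x - y)⟫_ℝ + κ * FunctionSpaces.Torus.laplacian k (x - y))) +
        ∫ y, s τ y * k (x - y))‖
      ≤ ∫ τ in Ioc 0 σ, bound τ := by
        refine norm_integral_le_of_norm_le (hbi.mono_set hsub) ?_
        exact ae_restrict_of_ae_restrict_of_subset hsub (hGb.mono fun τ hτ => hτ x)
    _ ≤ ∫ τ, bound τ ∂μT :=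
        integral_mono_measure hle (hGb.mono fun τ hτ => (norm_nonneg _).trans (hτ x)) hbi

/-! ## The mollified primitive paired with a steady smooth field is the trace -/

/-- **The mollified time primitive at time `σ`, paired with a smooth field `g`, is the trace
of `t ↦ ∫ a(t) (g ⋆ k)` at `σ`**: for an even smooth kernel `k`, integrable datum and every
`σ ∈ [0, T)`,
`∫ ((θ₀ ⋆ k)(x) + ∫_{(0,σ]} (G + S)(τ, x) dτ) g(x) dx =
 ∫ θ₀ (g ⋆ k) + ∫_{(0,σ]} (∫ θ(τ) (⟪u(τ), ∇(g ⋆ k)⟫ + κ Δ(g ⋆ k)) + ∫ s(τ) (g ⋆ k)) dτ`.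
[cite: DiPernaLions1989, §II.1 (13)–(14)] -/
theorem integral_molIntRep_mul_eq_trace (h : IsWeakScalarTransportForcedOn T κ u s θ₀ θ)
    (hθ₀ : Integrable θ₀ volume) {k : UnitAddTorus d → ℝ} (hk : FunctionSpaces.Torus.IsSmooth k)
    (hke : ∀ z, k (-z) = k z) {g : UnitAddTorus d → ℝ} (hg : FunctionSpaces.Torus.IsSmooth g)
    {σ : ℝ} (hσT : σ < T) :
    ∫ x, ((∫ y, θ₀ y * k (x - y)) + ∫ τ in Ioc 0 σ, ((∫ y, θ τ y *
        (-⟪u τ y, FunctionSpaces.Torus.gradient k (x - y)⟫_ℝ + κ * FunctionSpaces.Torus.laplacian k (x - y))) +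
        ∫ y, s τ y * k (x - y))) * g x =
      (∫ y, θ₀ y * (g ⋆ k) y) + ∫ τ in Ioc 0 σ, ((∫ y, θ τ y *
        (⟪u τ y, FunctionSpaces.Torus.gradient (g ⋆ k) y⟫_ℝ + κ * FunctionSpaces.Torus.laplacian (g ⋆ k) y)) +
        ∫ y, s τ y * (g ⋆ k) y) := by
  set μT : Measure ℝ := (volume : Measure ℝ).restrict (Ioo 0 T) with hμT
  obtain ⟨Cg, hCg⟩ := FunctionSpaces.Torus.exists_forall_norm_le_of_continuous hg.continuous
  obtain ⟨bound, hbi, hGb⟩ := h.exists_flux_bound₁ hk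
  have hsub : Ioc 0 σ ⊆ Ioo 0 T := Ioc_subset_Ioo_right hσT
  have hle : (volume : Measure ℝ).restrict (Ioc 0 σ) ≤ μT := Measure.restrict_mono_set _ hsub
  have hA0c : Continuous fun x => ∫ y, θ₀ y * k (x - y) := by
    have e : (fun x => ∫ y, θ₀ y * k (x - y)) = θ₀ ⋆ k := by
      funext x; simp only [convolution_lsmul, smul_eq_mul]
    rw [e]; exact FunctionSpaces.Torus.continuous_convolution hθ₀ hk.continuous
  have hI := h.integrable_setIntegral_fluxSource hk hσT
  -- split the left-hand side
  have e1 : (fun x => ((∫ y, θ₀ y * k (x - y)) + ∫ τ in Ioc 0 σ, ((∫ y, θ τ y *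
      (-⟪u τ y, FunctionSpaces.Torus.gradient k (x - y)⟫_ℝ + κ * FunctionSpaces.Torus.laplacian k (x - y))) +
      ∫ y, s τ y * k (x - y))) * g x) =
      fun x => g x * (∫ y, θ₀ y * k (x - y)) + g x * ∫ τ in Ioc 0 σ, ((∫ y, θ τ y *
        (-⟪u τ y, FunctionSpaces.Torus.gradient k (x - y)⟫_ℝ + κ * FunctionSpaces.Torus.laplacian k (x - y))) +
        ∫ y, s τ y * k (x - y)) := by
    funext x; ring
  have i1 : Integrable (fun x => g x * ∫ y, θ₀ y * k (x - y)) volume :=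
    (hg.continuous.mul hA0c).integrable_unitAddTorus
  have i2 : Integrable (fun x => g x * ∫ τ in Ioc 0 σ, ((∫ y, θ τ y *
      (-⟪u τ y, FunctionSpaces.Torus.gradient k (x - y)⟫_ℝ + κ * FunctionSpaces.Torus.laplacian k (x - y))) +
      ∫ y, s τ y * k (x - y))) volume :=
    hI.bdd_mul hg.continuous.aestronglyMeasurable (Eventually.of_forall fun x => hCg x)
  rw [e1, integral_add i1 i2, integral_mul_molInt_eq hg.continuous hθ₀ hk.continuous hke]
  congr 1
  -- the time integral: swap `x` and `τ`
  have hFm : AEStronglyMeasurable (uncurry fun τ x => g x * ((∫ y, θ τ y *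
      (-⟪u τ y, FunctionSpaces.Torus.gradient k (x - y)⟫_ℝ + κ * FunctionSpaces.Torus.laplacian k (x - y))) +
      ∫ y, s τ y * k (x - y))) (((volume : Measure ℝ).restrict (Ioc 0 σ)).prod volume) :=
    ((hg.continuous.comp continuous_snd).aestronglyMeasurable).mul
      (((h.aestronglyMeasurable_uncurry_flux₁ hk).add (h.aestronglyMeasurable_uncurry_sourceMol hk.continuous)).mono_measure
        (Measure.prod_mono hle le_rfl))
  have hFi : Integrable (uncurry fun τ x => g x * ((∫ y, θ τ y *
      (-⟪u τ y, FunctionSpaces.Torus.gradient k (x - y)⟫_ℝ + κ * FunctionSpaces.Torus.laplacian k (x - y))) +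
      ∫ y, s τ y * k (x - y))) (((volume : Measure ℝ).restrict (Ioc 0 σ)).prod volume) := by
    have hBi : Integrable (fun p : ℝ × UnitAddTorus d => bound p.1 * Cg) (((volume : Measure ℝ).restrict (Ioc 0 σ)).prod volume) :=
      (hbi.mono_set hsub).mul_prod (integrable_const Cg)
    refine Integrable.mono' hBi hFm ?_
    have hae : ∀ᵐ τ ∂((volume : Measure ℝ).restrict (Ioc 0 σ)), ∀ x, ‖g x * ((∫ y, θ τ y *
        (-⟪u τ y, FunctionSpaces.Torus.gradient k (x - y)⟫_ℝ + κ * FunctionSpaces.Torus.laplacian k (x - y))) +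
        ∫ y, s τ y * k (x - y))‖ ≤ bound τ * Cg := by
      filter_upwards [ae_restrict_of_ae_restrict_of_subset hsub hGb] with τ hτ x
      rw [norm_mul, mul_comm]
      exact mul_le_mul (hτ x) (hCg x) (norm_nonneg _) ((norm_nonneg _).trans (hτ x))
    have := (Measure.quasiMeasurePreserving_fst (μ := (volume : Measure ℝ).restrict (Ioc 0 σ))
      (ν := (volume : Measure (UnitAddTorus d)))).ae hae
    filter_upwards [this] with p hp
    exact hp p.2
  have eswap : ∫ x, g x * ∫ τ in Ioc 0 σ, ((∫ y, θ τ y *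
      (-⟪u τ y, FunctionSpaces.Torus.gradient k (x - y)⟫_ℝ + κ * FunctionSpaces.Torus.laplacian k (x - y))) +
      ∫ y, s τ y * k (x - y)) =
      ∫ τ in Ioc 0 σ, ∫ x, g x * ((∫ y, θ τ y *
        (-⟪u τ y, FunctionSpaces.Torus.gradient k (x - y)⟫_ℝ + κ * FunctionSpaces.Torus.laplacian k (x - y))) +
        ∫ y, s τ y * k (x - y)) := by
    have e2 : (fun x => g x * ∫ τ in Ioc 0 σ, ((∫ y, θ τ y *
        (-⟪u τ y, FunctionSpaces.Torus.gradient k (x - y)⟫_ℝ + κ * FunctionSpaces.Torus.laplacian k (x - y))) +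
        ∫ y, s τ y * k (x - y))) = fun x => ∫ τ in Ioc 0 σ, g x * ((∫ y, θ τ y *
        (-⟪u τ y, FunctionSpaces.Torus.gradient k (x - y)⟫_ℝ + κ * FunctionSpaces.Torus.laplacian k (x - y))) +
        ∫ y, s τ y * k (x - y)) := by
      funext x; exact (MeasureTheory.integral_const_mul _ _).symm
    rw [e2]
    exact integral_integral_swap (f := fun x τ => g x * ((∫ y, θ τ y *
        (-⟪u τ y, FunctionSpaces.Torus.gradient k (x - y)⟫_ℝ + κ * FunctionSpaces.Torus.laplacian k (x - y))) +
        ∫ y, s τ y * k (x - y))) hFi.swap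
  rw [eswap]
  refine integral_congr_ae ?_
  filter_upwards [ae_restrict_of_ae_restrict_of_subset hsub h.ae_slice_integrable₁] with τ hτ
  obtain ⟨hθi, hum, huθ, hsi⟩ := hτ
  have hGc := continuous_fluxIntegral hθi hum huθ hk κ
  have hSc : Continuous fun x => ∫ y, s τ y * k (x - y) := by
    have e : (fun x => ∫ y, s τ y * k (x - y)) = s τ ⋆ k := by
      funext x; simp only [convolution_lsmul, smul_eq_mul]
    rw [e]; exact FunctionSpaces.Torus.continuous_convolution hsi hk.continuous
  have j1 : Integrable (fun x => g x * ∫ y, θ τ y *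
      (-⟪u τ y, FunctionSpaces.Torus.gradient k (x - y)⟫_ℝ + κ * FunctionSpaces.Torus.laplacian k (x - y))) volume :=
    (hg.continuous.mul hGc).integrable_unitAddTorus
  have j2 : Integrable (fun x => g x * ∫ y, s τ y * k (x - y)) volume :=
    (hg.continuous.mul hSc).integrable_unitAddTorus
  have e3 : ∫ x, g x * ((∫ y, θ τ y *
      (-⟪u τ y, FunctionSpaces.Torus.gradient k (x - y)⟫_ℝ + κ * FunctionSpaces.Torus.laplacian k (x - y))) +
      ∫ y, s τ y * k (x - y)) = ∫ x, (g x * (∫ y, θ τ y *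
      (-⟪u τ y, FunctionSpaces.Torus.gradient k (x - y)⟫_ℝ + κ * FunctionSpaces.Torus.laplacian k (x - y))) +
      g x * ∫ y, s τ y * k (x - y)) :=
    integral_congr_ae (Eventually.of_forall fun x => mul_add _ _ _)
  rw [e3, integral_add j1 j2, integral_mul_fluxIntegral_eq hg.continuous hθi hum huθ hk hke κ,
    integral_mul_molInt_eq hg.continuous hsi hk.continuous hke]


/-! ## Continuity of the trace in the smooth field along mollifications -/

omit [Fintype d] in
/-- Pointwise convergence from eventual uniform closeness. [folklore] -/
theorem tendsto_apply_of_eventually_forall_norm_sub_le {E : Type*} [NormedAddCommGroup E] {X : Type*}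
    {F : ℕ → X → E} {f : X → E} (h : ∀ η : ℝ, 0 < η → ∀ᶠ n in atTop, ∀ y, ‖F n y - f y‖ ≤ η) (y : X) :
    Tendsto (fun n => F n y) atTop (𝓝 (f y)) := by
  rw [Metric.tendsto_atTop]
  intro ε hε
  obtain ⟨N, hN⟩ := eventually_atTop.1 (h (ε / 2) (half_pos hε))
  exact ⟨N, fun n hn => by rw [dist_eq_norm]; exact (hN n hn y).trans_lt (half_lt_self hε)⟩

/-- **The trace depends continuously on the smooth field along mollifications**: for kernels
`kₙ ≥ 0` of unit mass, smooth, with `support kₙ ⊆ B(0, δₙ)`, `δₙ → 0`,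
`P_{g ⋆ kₙ}(σ) → P_g(σ)`, where
`P_g(σ) = ∫ θ₀ g + ∫_{(0,σ]} (∫ θ(τ) (⟪u(τ), ∇g⟫ + κ Δg) + ∫ s(τ) g) dτ`
(uniform convergence of `g ⋆ kₙ` with two derivatives, dominated convergence).
[cite: DiPernaLions1989, §II.1 (13)–(14)] -/
theorem tendsto_trace_convolution (h : IsWeakScalarTransportForcedOn T κ u s θ₀ θ) (hθ₀ : Integrable θ₀ volume)
    {g : UnitAddTorus d → ℝ} (hg : FunctionSpaces.Torus.IsSmooth g)
    {k : ℕ → UnitAddTorus d → ℝ} {δ : ℕ → ℝ} (hkS : ∀ n, FunctionSpaces.Torus.IsSmooth (k n))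
    (hk0 : ∀ n y, 0 ≤ k n y) (hk1 : ∀ n, ∫ y, k n y = 1) (hks : ∀ n, support (k n) ⊆ ball 0 (δ n))
    (hδ : Tendsto δ atTop (𝓝 0)) {σ : ℝ} (hσT : σ < T) :
    Tendsto (fun n => (∫ y, θ₀ y * (g ⋆ k n) y) + ∫ τ in Ioc 0 σ, ((∫ y, θ τ y *
        (⟪u τ y, FunctionSpaces.Torus.gradient (g ⋆ k n) y⟫_ℝ + κ * FunctionSpaces.Torus.laplacian (g ⋆ k n) y)) +
        ∫ y, s τ y * (g ⋆ k n) y)) atTop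
      (𝓝 ((∫ y, θ₀ y * g y) + ∫ τ in Ioc 0 σ, ((∫ y, θ τ y *
        (⟪u τ y, FunctionSpaces.Torus.gradient g y⟫_ℝ + κ * FunctionSpaces.Torus.laplacian g y)) +
        ∫ y, s τ y * g y))) := by
  set μT : Measure ℝ := (volume : Measure ℝ).restrict (Ioo 0 T) with hμT
  have hsub : Ioc 0 σ ⊆ Ioo 0 T := Ioc_subset_Ioo_right hσT
  have hle : (volume : Measure ℝ).restrict (Ioc 0 σ) ≤ μT := Measure.restrict_mono_set _ hsub
  have hki : ∀ n, Integrable (k n) volume := fun n => (hkS n).continuous.integrable_unitAddTorus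
  have hgi : Integrable g volume := hg.continuous.integrable_unitAddTorus
  -- the mollified fields and their derivatives
  have hgn : ∀ n, FunctionSpaces.Torus.IsSmooth (g ⋆ k n) := fun n => FunctionSpaces.Torus.isSmooth_convolution hgi (hkS n)
  have hcomm : ∀ n, g ⋆ k n = k n ⋆ g := fun n => FunctionSpaces.Torus.convolution_comm_real g (k n)
  have hgrad : ∀ n y, FunctionSpaces.Torus.gradient (g ⋆ k n) y = (k n ⋆ FunctionSpaces.Torus.gradient g) y :=
    fun n y => by rw [hcomm n, FunctionSpaces.Torus.gradient_convolution (hki n) hg y]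
  have hlap : ∀ n y, FunctionSpaces.Torus.laplacian (g ⋆ k n) y = (k n ⋆ FunctionSpaces.Torus.laplacian g) y :=
    fun n y => by rw [hcomm n, FunctionSpaces.Torus.laplacian_convolution (hki n) hg y]
  obtain ⟨Cg, hCg⟩ := FunctionSpaces.Torus.exists_forall_norm_le_of_continuous hg.continuous
  obtain ⟨C₂, hC₂⟩ := FunctionSpaces.Torus.exists_forall_norm_le_of_continuous hg.gradient.continuous
  obtain ⟨C₃, hC₃⟩ := FunctionSpaces.Torus.exists_forall_norm_le_of_continuous hg.laplacian.continuous
  have hbg : ∀ n y, |(g ⋆ k n) y| ≤ Cg := fun n y =>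
    abs_convolution_le_of_forall_abs_le hg.continuous.aestronglyMeasurable
      (fun x => by rw [← Real.norm_eq_abs]; exact hCg x) (hk0 n) (hk1 n) y
  have hbgrad : ∀ n y, ‖FunctionSpaces.Torus.gradient (g ⋆ k n) y‖ ≤ C₂ := fun n y => by
    rw [hgrad]; exact norm_convolution_le_of_forall_norm_le hg.gradient.continuous.aestronglyMeasurable hC₂ (hk0 n) (hk1 n) y
  have hblap : ∀ n y, ‖FunctionSpaces.Torus.laplacian (g ⋆ k n) y‖ ≤ C₃ := fun n y => by
    rw [hlap]; exact norm_convolution_le_of_forall_norm_le hg.laplacian.continuous.aestronglyMeasurable hC₃ (hk0 n) (hk1 n) y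
  -- pointwise convergence of the mollified fields and derivatives
  have hpg : ∀ y, Tendsto (fun n => (g ⋆ k n) y) atTop (𝓝 (g y)) :=
    tendsto_apply_of_eventually_forall_norm_sub_le fun η hη => by
      filter_upwards [eventually_forall_abs_convolution_sub_le hg.continuous hk0 hk1 hks hδ hη] with n hn y
      rw [Real.norm_eq_abs]; exact hn y
  have hpgrad : ∀ y, Tendsto (fun n => FunctionSpaces.Torus.gradient (g ⋆ k n) y) atTop
      (𝓝 (FunctionSpaces.Torus.gradient g y)) := by
    intro y
    have := tendsto_apply_of_eventually_forall_norm_sub_le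
      (fun η hη => eventually_forall_norm_convolution_sub_le hg.gradient.continuous hk0 hk1 hks hδ hη) y
    simpa only [← hgrad] using this
  have hplap : ∀ y, Tendsto (fun n => FunctionSpaces.Torus.laplacian (g ⋆ k n) y) atTop
      (𝓝 (FunctionSpaces.Torus.laplacian g y)) := by
    intro y
    have := tendsto_apply_of_eventually_forall_norm_sub_le
      (fun η hη => eventually_forall_norm_convolution_sub_le hg.laplacian.continuous hk0 hk1 hks hδ hη) y
    simpa only [← hlap] using this
  refine Tendsto.add ?_ ?_
  · -- the datum term
    refine tendsto_integral_of_dominated_convergence (fun y => Cg * |θ₀ y|) (fun n => ?_) (hθ₀.abs.const_mul Cg)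
      (fun n => Eventually.of_forall fun y => ?_) (Eventually.of_forall fun y => (hpg y).const_mul (θ₀ y))
    · exact hθ₀.aestronglyMeasurable.mul (hgn n).continuous.aestronglyMeasurable
    · rw [norm_mul, Real.norm_eq_abs, Real.norm_eq_abs, mul_comm]
      exact mul_le_mul_of_nonneg_right (hbg n y) (abs_nonneg _)
  · -- the time integral: dominated convergence in `τ`
    set bnd : ℝ → ℝ := fun τ => (∫ y, (C₂ * (‖u τ y‖ * |θ τ y|) + |κ| * C₃ * |θ τ y|)) + ∫ y, Cg * |s τ y| with hbnd
    have hbndi : Integrable bnd μT := by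
      have i1 : Integrable (fun τ => ∫ y, (C₂ * (‖u τ y‖ * |θ τ y|) + |κ| * C₃ * |θ τ y|)) μT := by
        have j : Integrable (fun p : ℝ × UnitAddTorus d => C₂ * (‖u p.1 p.2‖ * |θ p.1 p.2|) + |κ| * C₃ * |θ p.1 p.2|)
            (μT.prod volume) := by
          have j1 : Integrable (fun p : ℝ × UnitAddTorus d => ‖u p.1 p.2‖ * |θ p.1 p.2|) (μT.prod volume) := by
            refine h.integrable_norm_velocity_mul.norm.congr (Eventually.of_forall fun p => ?_)
            simp [Real.norm_eq_abs]
          have j2 : Integrable (fun p : ℝ × UnitAddTorus d => |θ p.1 p.2|) (μT.prod volume) := by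
            refine h.integrable_uncurry.norm.congr (Eventually.of_forall fun p => ?_)
            simp [Real.norm_eq_abs, uncurry]
          exact (j1.const_mul C₂).add (j2.const_mul (|κ| * C₃))
        exact j.integral_prod_left
      have i2 : Integrable (fun τ => ∫ y, Cg * |s τ y|) μT := by
        have j : Integrable (fun p : ℝ × UnitAddTorus d => Cg * |s p.1 p.2|) (μT.prod volume) := by
          refine (h.integrable_uncurry_source.norm.const_mul Cg).congr (Eventually.of_forall fun p => ?_)
          simp [Real.norm_eq_abs, uncurry]
        exact j.integral_prod_left
      exact i1.add i2
    refine tendsto_integral_of_dominated_convergence bnd (fun n => ?_) (hbndi.mono_measure hle) (fun n => ?_) ?_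
    · -- measurability in `τ`
      exact ((h.integrable_mul_steadyFlux (hgn n)).integral_prod_left.add
        (h.integrable_source_mul_continuous (hgn n).continuous).integral_prod_left).aestronglyMeasurable.mono_measure hle
    · -- domination
      refine ae_restrict_of_ae_restrict_of_subset hsub ?_
      filter_upwards [h.ae_slice_integrable₁] with τ hτ
      obtain ⟨hθi, hum, huθ, hsi⟩ := hτ
      have hvi : Integrable (fun y => ‖u τ y‖ * |θ τ y|) volume := by
        refine huθ.norm.congr (Eventually.of_forall fun y => ?_)
        simp [Real.norm_eq_abs]
      rw [Real.norm_eq_abs]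
      refine (abs_add_le _ _).trans (add_le_add ?_ ?_)
      · refine (abs_integral_le_integral_abs).trans (integral_mono_of_nonneg (Eventually.of_forall fun y => abs_nonneg _)
          ((hvi.const_mul C₂).add (hθi.abs.const_mul _)) (Eventually.of_forall fun y => ?_))
        dsimp only
        rw [abs_mul]
        have h1 : |⟪u τ y, FunctionSpaces.Torus.gradient (g ⋆ k n) y⟫_ℝ| ≤ ‖u τ y‖ * C₂ :=
          (abs_real_inner_le_norm _ _).trans (mul_le_mul_of_nonneg_left (hbgrad n y) (norm_nonneg _))
        have h2 : |κ * FunctionSpaces.Torus.laplacian (g ⋆ k n) y| ≤ |κ| * C₃ := by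
          rw [abs_mul]
          exact mul_le_mul_of_nonneg_left (by simpa [Real.norm_eq_abs] using hblap n y) (abs_nonneg _)
        calc |θ τ y| * |⟪u τ y, FunctionSpaces.Torus.gradient (g ⋆ k n) y⟫_ℝ + κ * FunctionSpaces.Torus.laplacian (g ⋆ k n) y|
            ≤ |θ τ y| * (‖u τ y‖ * C₂ + |κ| * C₃) :=
              mul_le_mul_of_nonneg_left ((abs_add_le _ _).trans (add_le_add h1 h2)) (abs_nonneg _)
          _ = C₂ * (‖u τ y‖ * |θ τ y|) + |κ| * C₃ * |θ τ y| := by ring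
      · refine (abs_integral_le_integral_abs).trans (integral_mono_of_nonneg (Eventually.of_forall fun y => abs_nonneg _)
          (hsi.abs.const_mul Cg) (Eventually.of_forall fun y => ?_))
        dsimp only
        rw [abs_mul, mul_comm]
        exact mul_le_mul_of_nonneg_right (hbg n y) (abs_nonneg _)
    · -- pointwise convergence in `τ`
      refine ae_restrict_of_ae_restrict_of_subset hsub ?_
      filter_upwards [h.ae_slice_integrable₁] with τ hτ
      obtain ⟨hθi, hum, huθ, hsi⟩ := hτ
      have hvi : Integrable (fun y => ‖u τ y‖ * |θ τ y|) volume := by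
        refine huθ.norm.congr (Eventually.of_forall fun y => ?_)
        simp [Real.norm_eq_abs]
      refine Tendsto.add ?_ ?_
      · refine tendsto_integral_of_dominated_convergence (fun y => C₂ * (‖u τ y‖ * |θ τ y|) + |κ| * C₃ * |θ τ y|)
          (fun n => ?_) ((hvi.const_mul C₂).add (hθi.abs.const_mul _)) (fun n => Eventually.of_forall fun y => ?_)
          (Eventually.of_forall fun y => ?_)
        · exact hθi.aestronglyMeasurable.mul ((hum.inner (hgn n).gradient.continuous.aestronglyMeasurable).add
            (aestronglyMeasurable_const.mul (hgn n).laplacian.continuous.aestronglyMeasurable))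
        · rw [norm_mul, Real.norm_eq_abs, Real.norm_eq_abs]
          have h1 : |⟪u τ y, FunctionSpaces.Torus.gradient (g ⋆ k n) y⟫_ℝ| ≤ ‖u τ y‖ * C₂ :=
            (abs_real_inner_le_norm _ _).trans (mul_le_mul_of_nonneg_left (hbgrad n y) (norm_nonneg _))
          have h2 : |κ * FunctionSpaces.Torus.laplacian (g ⋆ k n) y| ≤ |κ| * C₃ := by
            rw [abs_mul]
            exact mul_le_mul_of_nonneg_left (by simpa [Real.norm_eq_abs] using hblap n y) (abs_nonneg _)
          calc |θ τ y| * |⟪u τ y, FunctionSpaces.Torus.gradient (g ⋆ k n) y⟫_ℝ + κ * FunctionSpaces.Torus.laplacian (g ⋆ k n) y|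
              ≤ |θ τ y| * (‖u τ y‖ * C₂ + |κ| * C₃) :=
                mul_le_mul_of_nonneg_left ((abs_add_le _ _).trans (add_le_add h1 h2)) (abs_nonneg _)
            _ = C₂ * (‖u τ y‖ * |θ τ y|) + |κ| * C₃ * |θ τ y| := by ring
        · have h3 : Tendsto (fun n => ⟪u τ y, FunctionSpaces.Torus.gradient (g ⋆ k n) y⟫_ℝ) atTop
              (𝓝 ⟪u τ y, FunctionSpaces.Torus.gradient g y⟫_ℝ) := (tendsto_const_nhds).inner (hpgrad y)
          exact (h3.add ((hplap y).const_mul κ)).const_mul (θ τ y)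
      · refine tendsto_integral_of_dominated_convergence (fun y => Cg * |s τ y|) (fun n => ?_) (hsi.abs.const_mul Cg)
          (fun n => Eventually.of_forall fun y => ?_) (Eventually.of_forall fun y => (hpg y).const_mul (s τ y))
        · exact hsi.aestronglyMeasurable.mul (hgn n).continuous.aestronglyMeasurable
        · rw [norm_mul, Real.norm_eq_abs, Real.norm_eq_abs, mul_comm]
          exact mul_le_mul_of_nonneg_right (hbg n y) (abs_nonneg _)

end IsWeakScalarTransportForcedOn

end Torus

end Literature.Analysis.FluidPDE
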